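import Mathlib.Tactic
import HarnessLib
import HarnessLib.Audit.Tags
import Summits.CriticalPhenomena.PercolationContinuityZ3.Theorems.PercNearOneGluingNoHeavyLowerTailSahiRainbowMax

/-!
# The max-antichain accounting: the meet-rich / meet-poor dichotomy, and the rainbow lemma without small covers

Support file (seat `prim-masterthm-p1`, gen 39; `--supports stmt-CriticalPhenomena-4575`).  Two typed statements, their reduction to
`AntichainAvailHall` (`…SahiRainbowMax`), and an unconditional corollary of the generic-position theorem; no `sorry`, standard axioms.
Memo `run/shared/lean/prim/prim-masterthm/FROM-prim-masterthm-p1-g39-MAX-ACCOUNTING.md` §3–§4.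

SETTING (`…SahiRainbowMax`): `A ⊆ 2^F` a complement-free antichain, `rainbowMeets F A = {∅} ∪ meets ∪ complemented joins`,
`X ⊆ A` with `F \ x ∉ rainbowMeets F A` for `x ∈ X`; `availColours F A X` = colours `t` with `F \ t ∉ A` that lie strictly inside a member
of `X` or strictly inside no member of `A`; `AntichainAvailHall`: `#X ≤ #availColours F A X` (⟹ the rainbow lemma).

NEW HERE ([this work], gen 39).  Write `L(A) = {∅} ∪ meets A`.  The available colours split into a MEET SIDE `availMeetSide` (`∅`, the
colours lying strictly inside no member, and the meets lying strictly inside a member of `X`) and a COJOIN SIDE `availCojoinSide` (`∅` and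
the available complemented joins).  EXHAUSTIVELY on `2^5` and `2^6` (every complement-free antichain `A`, every admissible `X`:
556 194 881 pairs; engines `prim-masterthm-p1/code-g39/t5.c`, `t6.c`; random checks in `2^7 … 2^10`, `dich_rand.c`), with no exception:
* `AntichainMeetRichHall` (typed, [status: open]): if `#A ≤ #L(A)` (the meets of `A` alone could pay for `A`) then the MEET SIDE pays
  every `X`: `#X ≤ #availMeetSide F A X`;
* `AntichainMeetPoorHall` (typed, [status: open]): if `#L(A) < #A` then the COJOIN SIDE pays every `X`: `#X ≤ #availCojoinSide F A X`.
So the GLOBAL type of the maximal antichain decides which half is robust against blocking and swallowing by outsiders (the sum of the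
two sides is NOT additive: a sunflower `{K ∪ pᵢ}` plus the blocker `F \ K` has all its complemented joins swallowed and is paid by the
cross meets `pᵢ` alone).  `antichainAvailHall_of_dichotomy`: the two statements imply `AntichainAvailHall`, hence the rainbow lemma
(`rainbowMeetCojoin_of_dichotomy`).
* UNCONDITIONAL (`card_le_card_rainbowMeets_of_no_small_cover`): if no one, two or three maximal members of the complement-free family
  `P` cover `F`, then `#P ≤ #rainbowMeets F P` — such families are in generic position (a maximal member complementary to a meet of two
  maximal members covers `F` with either of them; a maximal member strictly containing a complemented join covers `F` with that pair).
HONEST FRAMING: `AntichainMeetRichHall`, `AntichainMeetPoorHall`, `AntichainAvailHall`, `RainbowMeetCojoin` remain OPEN; the reductions and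
the no-small-cover theorem are unconditional. [this work]
-/

namespace Summit.CriticalPhenomena.PercolationContinuityZ3.Theorems.SahiColouredDaykin

open Finset

variable {α : Type*} [DecidableEq α]

/-! ### 1. The two sides of the available colours -/

/-- The MEET SIDE of the available colours: `∅`, the available colours lying strictly inside no member of `A` (necessarily complemented
joins), and the available meets lying strictly inside some member of `X`. [this work] -/
def availMeetSide (F : Finset α) (A X : Finset (Finset α)) : Finset (Finset α) :=
  (availColours F A X).filter fun t => t = ∅ ∨ (t ∉ meets A ∧ ∀ a ∈ A, ¬ t ⊂ a) ∨ (t ∈ meets A ∧ ∃ x ∈ X, t ⊂ x)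

/-- The COJOIN SIDE of the available colours: `∅` and the available complemented joins. [this work] -/
def availCojoinSide (F : Finset α) (A X : Finset (Finset α)) : Finset (Finset α) :=
  (availColours F A X).filter fun t => t = ∅ ∨ t ∈ (joins A).image (F \ ·)

/-- The meet side consists of available colours. [this work] -/
theorem availMeetSide_subset (F : Finset α) (A X : Finset (Finset α)) : availMeetSide F A X ⊆ availColours F A X :=
  filter_subset _ _

/-- The cojoin side consists of available colours. [this work] -/
theorem availCojoinSide_subset (F : Finset α) (A X : Finset (Finset α)) : availCojoinSide F A X ⊆ availColours F A X :=
  filter_subset _ _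

/-- **CONJECTURE (meet-rich antichains: the meet side is robust; typed).**  If the meets of the complement-free antichain `A` together
with `∅` number at least `#A`, then for every admissible `X ⊆ A` the meet side of the available colours pays for `X`.  Exhaustive on
`2^5`, `2^6` (file header). [this work] [status: open] -/
@[conjecture] def AntichainMeetRichHall (α : Type*) [DecidableEq α] : Prop :=
  ∀ (F : Finset α) (A X : Finset (Finset α)),
    (∀ a ∈ A, a ⊆ F) → (∀ a ∈ A, F \ a ∉ A) → IsAntichain (· ⊆ ·) (A : Set (Finset α)) →
    X ⊆ A → (∀ x ∈ X, F \ x ∉ rainbowMeets F A) → #A ≤ #(insert ∅ (meets A)) →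
    #X ≤ #(availMeetSide F A X)

/-- **CONJECTURE (meet-poor antichains: the cojoin side is robust; typed).**  If the meets of the complement-free antichain `A` together
with `∅` number fewer than `#A`, then for every admissible `X ⊆ A` the cojoin side of the available colours pays for `X`.  Exhaustive on
`2^5`, `2^6` (file header). [this work] [status: open] -/
@[conjecture] def AntichainMeetPoorHall (α : Type*) [DecidableEq α] : Prop :=
  ∀ (F : Finset α) (A X : Finset (Finset α)),
    (∀ a ∈ A, a ⊆ F) → (∀ a ∈ A, F \ a ∉ A) → IsAntichain (· ⊆ ·) (A : Set (Finset α)) →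
    X ⊆ A → (∀ x ∈ X, F \ x ∉ rainbowMeets F A) → #(insert ∅ (meets A)) < #A →
    #X ≤ #(availCojoinSide F A X)

/-- **The dichotomy implies the Hall condition** `AntichainAvailHall`. [this work] -/
theorem antichainAvailHall_of_dichotomy (h₁ : AntichainMeetRichHall α) (h₂ : AntichainMeetPoorHall α) :
    AntichainAvailHall α := by
  intro F A X hAF hcf hanti hXA hX
  by_cases hL : #A ≤ #(insert ∅ (meets A))
  · exact (h₁ F A X hAF hcf hanti hXA hX hL).trans (card_le_card (availMeetSide_subset F A X))
  · exact (h₂ F A X hAF hcf hanti hXA hX (by omega)).trans (card_le_card (availCojoinSide_subset F A X))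

/-- **The dichotomy implies the rainbow lemma.** [this work] -/
theorem rainbowMeetCojoin_of_dichotomy (h₁ : AntichainMeetRichHall α) (h₂ : AntichainMeetPoorHall α) : RainbowMeetCojoin α :=
  rainbowMeetCojoin_of_antichainAvailHall (antichainAvailHall_of_dichotomy h₁ h₂)

/-! ### 2. No small covers: an unconditional instance -/

section NoSmallCover

variable {F : Finset α} {P : Finset (Finset α)}

/-- **The rainbow lemma without small covers.**  If no three (not necessarily distinct) maximal members of the complement-free family
`P ⊆ 2^F` have union `F`, then `#P ≤ #rainbowMeets F P`.  Indeed the maximal antichain is then in generic position: a maximal member `a`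
with `F \ a` a colour of the maximal antichain would cover `F` together with one other maximal member (or alone), and a maximal member
strictly containing `F \ (b ∪ c)` covers `F` together with `b` and `c`. [this work] -/
theorem card_le_card_rainbowMeets_of_no_small_cover (hPF : ∀ S ∈ P, S ⊆ F) (hcf : ∀ S ∈ P, F \ S ∉ P)
    (h3 : ∀ a ∈ maxMembers P, ∀ b ∈ maxMembers P, ∀ c ∈ maxMembers P, a ∪ b ∪ c ≠ F) :
    #P ≤ #(rainbowMeets F P) := by
  have hAP := maxMembers_subset P
  refine card_le_card_rainbowMeets_of_generic hPF hcf (fun a ha hmem => ?_) (fun a ha b hb c hc _ hlt => ?_)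
  · -- `F \ a` is a colour of the maximal antichain: then `a` alone, or `a` with one other maximal member, covers `F`
    have haF : a ⊆ F := hPF a (hAP ha)
    rcases mem_rainbowMeets_iff.1 hmem with h0 | ⟨b, hb, c, hc, hbc, h | h⟩
    · -- `F \ a = ∅`: `a = F`
      apply h3 a ha a ha a ha
      rw [union_self, union_self]
      refine Subset.antisymm haF fun x hx => ?_
      by_contra hxa
      have : x ∈ F \ a := mem_sdiff.2 ⟨hx, hxa⟩
      rw [h0] at this
      exact notMem_empty _ this
    · -- `F \ a = b ∩ c ⊆ b`: `a ∪ b = F`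
      apply h3 a ha b hb b hb
      rw [union_assoc, union_self]
      refine Subset.antisymm (union_subset haF (hPF b (hAP hb))) fun x hx => ?_
      by_cases hxa : x ∈ a
      · exact mem_union_left _ hxa
      · have : x ∈ F \ a := mem_sdiff.2 ⟨hx, hxa⟩
        rw [h] at this
        exact mem_union_right _ (mem_inter.1 this).1
    · -- `F \ a = F \ (b ∪ c)`: then `a = b ∪ c`, impossible in an antichain (this case is vacuous)
      exfalso
      have e : a = b ∪ c := by
        rw [← Finset.sdiff_sdiff_eq_self haF, h, Finset.sdiff_sdiff_eq_self (union_subset (hPF b (hAP hb)) (hPF c (hAP hc)))]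
      have hanti := isAntichain_maxMembers P
      by_cases hab : b = a
      · have hcb : c ⊆ b := by rw [hab, e]; exact subset_union_right
        exact hanti (mem_coe.2 hc) (mem_coe.2 hb) hbc.symm hcb
      · have hba : b ⊆ a := by rw [e]; exact subset_union_left
        exact hanti (mem_coe.2 hb) (mem_coe.2 ha) hab hba
  · -- `F \ (b ∪ c) ⊂ a`: then `a ∪ b ∪ c = F`
    apply h3 a ha b hb c hc
    refine Subset.antisymm (union_subset (union_subset (hPF a (hAP ha)) (hPF b (hAP hb))) (hPF c (hAP hc))) fun x hx => ?_
    by_cases hxbc : x ∈ b ∪ c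
    · rw [union_assoc]; exact mem_union_right _ hxbc
    · have : x ∈ F \ (b ∪ c) := mem_sdiff.2 ⟨hx, hxbc⟩
      exact mem_union_left _ (mem_union_left _ (hlt.1 this))

end NoSmallCover

end Summit.CriticalPhenomena.PercolationContinuityZ3.Theorems.SahiColouredDaykin
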